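import Mathlib.Algebra.Polynomial.Reverse
import Summits.Ventures.HSemireg.EmbeddedFirstOrderDeformationsCechNonzeroClass

/-!
# Venture HSemireg — the SEPARATED witness with non-zero Čech class: the zero section of `𝒪_{ℙ¹}(−2)` does not lift
# to the first-order smoothing of the `A₁`-singularity (Hartshorne, Thm. 6.2 (b); `H¹(ℙ¹, 𝒪(−2)) = k`)

HONEST FRAMING.  Lean side of the computation cell `pub-hsemireg` (track «S4-PUSH» (ii), seat s4-prove-3 g6, second
route for (S5)); log `s4push/prove-3/ATTEMPT-10.md` §5d.  The separated twin of `…CechNonzeroClass`: charts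
`U₀ = Spec k[s,p]`, `U₁ = Spec k[t,q]`, overlap `Spec k[s,s⁻¹,p]` with `t = s⁻¹`, `q = s²p` — the total space `X` of
`𝒪_{ℙ¹}(−2)` — the first-order deformation `q = s²p + εs` (twist `s⁻¹∂/∂p`), and `Z = V(p) ∪ V(q) ≅ ℙ¹` the zero
section.  Plain commutative algebra on `MvPolynomial (Fin 2) k` and `Localization.Away`; no Mathlib scheme, sheaf,
abelian variety or semiregularity map; nothing here says that HC, HC_CM or HC_AV holds; no object is certified; no
Literature fact is declared.

WHAT (namespace `Summit.Ventures.HSemireg.EmbeddedDeformation.DoubledLine`, continuing `…CechNonzeroClass`):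
* (§1, the transport of flat lifts along a pair of ring isomorphisms `IsLift.map_ringEquivPair` / `mapRingEquiv`, and
  `eval₂Hom_pair_zero` now live in `…CechNonzeroClass` §0/§2, so that the later example files import that file directly.)
* §2 `psiHom : L →+* L`, `s ↦ s⁻¹`, `p ↦ s²p` (`IsLocalization.Away.lift` of `aeval`), an INVOLUTION (`psiHom_comp_psiHom`),
  packaged as `psi : L ≃+* L`; the chart maps `resM2 := ![localisation, psi ∘ localisation]`; both carry flat lifts
  (`preservesLifts_resM2` — chart 1 by `IsLift.map_ringEquivPair` + the localisation discharger + `(p)·L` is `psi`-stable).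
* §3 `thickenedAtlas_minusTwo` (local lifts: the trivial ones, `isLift_trivialLift_doubledLine` of `…CechNonzeroClass`
  — the same ideals `(p)·A[ε]` on every rung), **`not_exists_isAtlasLift_minusTwo`** and
  **`cechCochain_minusTwo_not_coboundary`**: the zero section has NO lift; the coboundary equation at `s²p = q`
  reads `s ≡ H(s⁻¹, s²p) − s²G(s, p) (mod p)`; under `s ↦ x`, `p ↦ 0` into `k[x]_x` and after clearing `x^N`
  (`Polynomial.reflect`) it becomes `X^{N+1} + X^{N+2}G₀ = reflect N H₀` in `k[X]`, whose coefficient at `N + 1`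
  reads `1 = 0` (`key_contradiction`).

References: R. Hartshorne, *Deformation Theory*, GTM 257 (2010), §6 Thm. 6.2 (b) [corpus:
book:springernd-deformation-theory p0054]; the example («a `(−2)`-curve disappears under the smoothing of the node it
contracts to») is folklore.
-/

namespace Summit.Ventures.HSemireg

namespace EmbeddedDeformation

open DualNumber TrivSqZeroExt MvPolynomial

universe u

namespace DoubledLine

variable (k : Type u) [CommRing k]

/-! ### §2 The coordinate change `s ↦ s⁻¹, p ↦ s²p` of the `(−2)`-bundle and the two chart maps -/

/-- `k[s,p] → k[s,s⁻¹,p]`, `s ↦ s⁻¹`, `p ↦ s²p` (the second chart of `𝒪_{ℙ¹}(−2)` read in the first chart's overlap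
coordinates: `t = s⁻¹`, `q = s²p`). -/
noncomputable def psi₀ : A k →+* L k :=
  (MvPolynomial.aeval ![IsLocalization.Away.invSelf (X 0 : A k),
    algebraMap (A k) (L k) (X 0) ^ 2 * algebraMap (A k) (L k) (X 1)]).toRingHom

/-- `psi₀ s = s⁻¹`. [folklore] -/
theorem psi₀_X_zero : psi₀ k (X 0) = IsLocalization.Away.invSelf (X 0 : A k) := by
  rw [psi₀, AlgHom.toRingHom_eq_coe, AlgHom.coe_toRingHom, MvPolynomial.aeval_X]; rfl

/-- `psi₀ p = s²p`. [folklore] -/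
theorem psi₀_X_one : psi₀ k (X 1) = algebraMap (A k) (L k) (X 0) ^ 2 * algebraMap (A k) (L k) (X 1) := by
  rw [psi₀, AlgHom.toRingHom_eq_coe, AlgHom.coe_toRingHom, MvPolynomial.aeval_X]; rfl

/-- `psi₀` on constants. [folklore] -/
theorem psi₀_C (c : k) : psi₀ k (C c) = algebraMap (A k) (L k) (C c) := by
  rw [psi₀, AlgHom.toRingHom_eq_coe, AlgHom.coe_toRingHom, MvPolynomial.algHom_C, ← MvPolynomial.algebraMap_eq]
  exact IsScalarTower.algebraMap_apply k (A k) (L k) c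

/-- `s⁻¹ · s = 1`, so `psi₀ s` is a unit. [folklore] -/
theorem isUnit_psi₀_X_zero : IsUnit (psi₀ k (X 0)) := by
  rw [psi₀_X_zero]
  exact IsUnit.of_mul_eq_one_right _ (IsLocalization.Away.mul_invSelf (S := L k) (X 0 : A k))

/-- The coordinate change extended to `L = k[s,s⁻¹,p]`. [folklore] -/
noncomputable def psiHom : L k →+* L k :=
  IsLocalization.Away.lift (X 0 : A k) (isUnit_psi₀_X_zero k)

/-- `psiHom (a/1) = psi₀ a`. [folklore] -/
theorem psiHom_algebraMap (a : A k) : psiHom k (algebraMap (A k) (L k) a) = psi₀ k a :=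
  IsLocalization.Away.lift_eq (X 0 : A k) (isUnit_psi₀_X_zero k) a

/-- `psiHom (s⁻¹) = s`. [folklore] -/
theorem psiHom_invSelf : psiHom k (IsLocalization.Away.invSelf (X 0 : A k)) = algebraMap (A k) (L k) (X 0) := by
  have h1 : psiHom k (algebraMap (A k) (L k) (X 0)) * psiHom k (IsLocalization.Away.invSelf (X 0 : A k)) = 1 := by
    rw [← map_mul, IsLocalization.Away.mul_invSelf, map_one]
  rw [psiHom_algebraMap, psi₀_X_zero] at h1
  -- `s⁻¹ · psiHom(s⁻¹) = 1` and `s⁻¹ · s = 1`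
  have h2 : IsLocalization.Away.invSelf (X 0 : A k) * algebraMap (A k) (L k) (X 0) = 1 := by
    rw [mul_comm, IsLocalization.Away.mul_invSelf]
  calc psiHom k (IsLocalization.Away.invSelf (X 0 : A k))
      = (IsLocalization.Away.invSelf (X 0 : A k) * algebraMap (A k) (L k) (X 0)) *
          psiHom k (IsLocalization.Away.invSelf (X 0 : A k)) := by rw [h2, one_mul]
    _ = algebraMap (A k) (L k) (X 0) *
          (IsLocalization.Away.invSelf (X 0 : A k) * psiHom k (IsLocalization.Away.invSelf (X 0 : A k))) := by ring
    _ = algebraMap (A k) (L k) (X 0) := by rw [h1, mul_one]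

/-- **`psiHom` is an involution** (`s ↦ s⁻¹ ↦ s`, `p ↦ s²p ↦ s⁻²·s²p = p`). [folklore] -/
theorem psiHom_comp_psiHom : (psiHom k).comp (psiHom k) = RingHom.id (L k) := by
  refine IsLocalization.ringHom_ext (Submonoid.powers (X 0 : A k)) ?_
  refine MvPolynomial.ringHom_ext (fun c ↦ ?_) (fun i ↦ ?_)
  · simp only [RingHom.comp_apply, RingHom.id_apply, ← MvPolynomial.algebraMap_eq]
    rw [MvPolynomial.algebraMap_eq, psiHom_algebraMap, psi₀_C, psiHom_algebraMap, psi₀_C]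
  · simp only [RingHom.comp_apply, RingHom.id_apply]
    fin_cases i
    · simp only [Fin.zero_eta, psiHom_algebraMap, psi₀_X_zero, psiHom_invSelf]
    · simp only [Fin.mk_one, psiHom_algebraMap, psi₀_X_one, map_mul, map_pow, psi₀_X_zero]
      rw [← mul_assoc, ← mul_pow, mul_comm (IsLocalization.Away.invSelf _), IsLocalization.Away.mul_invSelf, one_pow,
        one_mul]

/-- The coordinate change as a ring AUTOMORPHISM `psi : L ≃+* L`. [folklore] -/
noncomputable def psi : L k ≃+* L k :=
  RingEquiv.ofRingHom (psiHom k) (psiHom k) (psiHom_comp_psiHom k) (psiHom_comp_psiHom k)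

/-- The chart maps of `𝒪_{ℙ¹}(−2)` into the overlap: chart `0` the localisation, chart `1` the localisation followed
by the coordinate change. -/
noncomputable def resM2 : Fin 2 → (A k →+* L k) :=
  ![algebraMap (A k) (L k), (psi k : L k →+* L k).comp (algebraMap (A k) (L k))]

/-- `resM2 1 = psi ∘` localisation. -/
theorem resM2_one : resM2 k 1 = (psi k : L k →+* L k).comp (algebraMap (A k) (L k)) := rfl

/-- `resM2 1 (p) = s²p`. [folklore] -/
theorem resM2_one_X_one :
    resM2 k 1 (X 1) = algebraMap (A k) (L k) (X 0) ^ 2 * algebraMap (A k) (L k) (X 1) := by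
  rw [resM2_one, RingHom.comp_apply]
  change psiHom k _ = _
  rw [psiHom_algebraMap, psi₀_X_one]

/-- `(p)·L` is `psi`-stable: `psi((p)·L) = (s²p)·L = (p)·L`. [folklore] -/
theorem map_psi_idealZ₂ (α β : Fin 2) :
    (idealZ₂ k α β).map (psi k : L k →+* L k) = idealZ₂ k α β := by
  change ((Ideal.span {(X 1 : A k)}).map _).map _ = (Ideal.span {(X 1 : A k)}).map _
  rw [Ideal.map_map, Ideal.map_span, Ideal.map_span, Set.image_singleton, Set.image_singleton, RingHom.comp_apply]
  change Ideal.span {psiHom k _} = _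
  rw [psiHom_algebraMap, psi₀_X_one]
  exact Ideal.span_singleton_mul_left_unit ((IsLocalization.Away.algebraMap_isUnit (S := L k) (X 0 : A k)).pow 2) _

/-- **Both chart maps carry flat lifts** (chart `0`: the localisation discharger; chart `1`: localisation, then
transport along the automorphism `psi[ε]` over `psi`, then `psi`-stability of `(p)·L`). [folklore] -/
theorem preservesLifts_resM2 : ∀ α β : Fin 2,
    PreservesLifts (fstRingHom (A k)) (ε : (A k)[ε]) (fstRingHom (L k)) (ε : (L k)[ε]) (mapRingHom (resM2 k α))
      (idealZ k α) (idealZ₂ k α β) := by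
  intro α β
  fin_cases α
  · exact preservesLifts_mapRingHom_of_isLocalization (Submonoid.powers (X 0 : A k)) _
  · show PreservesLifts _ _ _ _ (mapRingHom (resM2 k 1)) (idealZ k 1) (idealZ₂ k 1 β)
    rw [resM2_one, mapRingHom_comp', ← coe_mapRingEquiv]
    intro K hK
    have h1 := preservesLifts_mapRingHom_of_isLocalization (S := L k) (Submonoid.powers (X 0 : A k)) (idealZ k 1) hK
    have h2 := h1.map_ringEquivPair (τ := fstRingHom (L k)) (e' := (ε : (L k)[ε])) (mapRingEquiv (psi k)) (psi k)
      (fun z ↦ by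
        show (mapRingHom (psi k : L k →+* L k) z).fst = psi k z.fst
        exact fst_mapRingHom _ z)
      (by
        show mapRingHom (psi k : L k →+* L k) ε = ε
        exact mapRingHom_eps _)
    rw [Ideal.map_map, Ideal.map_map] at h2
    have h3 : (idealZ k 1).map ((psi k : L k →+* L k).comp (algebraMap (A k) (L k))) = idealZ₂ k 1 β := by
      rw [← Ideal.map_map]
      exact map_psi_idealZ₂ k 1 β
    rw [h3] at h2
    exact h2
/-! ### §3 The zero section of `𝒪_{ℙ¹}(−2)` does not lift to the smoothing -/

/-- **The total space of `𝒪_{ℙ¹}(−2)` with its smoothing deformation IS a thickened atlas** (charts `k[s,p][ε]`,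
`k[t,q][ε]` — the same ring — overlap `k[s,s⁻¹,p][ε]`, chart maps `resM2`, twist `θ_αβ = (β − α)·s⁻¹∂/∂p`, so that
`q ↦ s²p + εs`). [folklore] -/
theorem thickenedAtlas_minusTwo :
    ThickenedAtlas (fun _ : Fin 2 ↦ fstRingHom (A k)) (fun _ ↦ (ε : (A k)[ε])) (fun _ _ ↦ fstRingHom (L k))
      (fun _ _ ↦ (ε : (L k)[ε])) (fun α _ ↦ mapRingHom (resM2 k α)) (fun α _ ↦ resM2 k α)
      (fun α β ↦ (twist (thetaFamily k α β) : (L k)[ε] →+* (L k)[ε]).comp (mapRingHom (resM2 k β)))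
      (fun _ β ↦ resM2 k β) (idealZ k) (idealZ₂ k) :=
  thickenedAtlas_twisted (fun α _ ↦ resM2 k α) (fun _ β ↦ resM2 k β) (idealZ k) (idealZ₂ k) (thetaFamily k)
    (preservesLifts_resM2 k) (fun α β ↦ preservesLifts_resM2 k β α)

/-- `ev ∘ psi₀ : k[s,p] → k[x]_x` is `s ↦ x⁻¹, p ↦ 0` (`x⁻¹ := ev s⁻¹`). [folklore] -/
theorem ev_comp_psi₀ :
    (ev k).comp (psi₀ k) =
      MvPolynomial.eval₂Hom (algebraMap k (Localization.Away (Polynomial.X : Polynomial k)))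
        ![ev k (IsLocalization.Away.invSelf (X 0 : A k)), 0] := by
  refine MvPolynomial.ringHom_ext (fun c ↦ ?_) (fun i ↦ ?_)
  · rw [RingHom.comp_apply, psi₀_C, ev_algebraMap_eq, MvPolynomial.eval₂Hom_C, MvPolynomial.eval₂_C,
      IsScalarTower.algebraMap_apply k (Polynomial k) (Localization.Away (Polynomial.X : Polynomial k)) c,
      Polynomial.algebraMap_eq]
  · fin_cases i
    · simp [psi₀_X_zero]
    · simp [psi₀_X_one, ev_algebraMap_X_one]

/-- **The Laurent-polynomial heart**: in `k[x]_x`, no polynomials `G, H ∈ k[x]` satisfy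
`x − (H(x⁻¹) − x²·G(x)) = 0` — clear denominators with `x^N` (`Polynomial.reflect`) and read off the coefficient of
`x^{N+1}`: `1 = 0`. [folklore] -/
theorem key_contradiction [Nontrivial k] (G H : Polynomial k) {u : Localization.Away (Polynomial.X : Polynomial k)}
    (hu : u * algebraMap (Polynomial k) (Localization.Away (Polynomial.X : Polynomial k)) Polynomial.X = 1)
    (h : algebraMap (Polynomial k) (Localization.Away (Polynomial.X : Polynomial k)) Polynomial.X -
        (Polynomial.eval₂ (algebraMap k _) u H -
          algebraMap (Polynomial k) _ Polynomial.X ^ 2 * algebraMap (Polynomial k) _ G) = 0) : False := by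
  set x : Localization.Away (Polynomial.X : Polynomial k) :=
    algebraMap (Polynomial k) (Localization.Away (Polynomial.X : Polynomial k)) Polynomial.X with hx
  haveI : Invertible x := ⟨u, hu, by rw [mul_comm]; exact hu⟩
  have hux : ⅟x = u := invOf_eq_left_inv hu
  have hrr : Polynomial.reflect H.natDegree (Polynomial.reflect H.natDegree H) = H :=
    Polynomial.ext fun i ↦ by rw [Polynomial.coeff_reflect, Polynomial.coeff_reflect, Polynomial.revAt_invol]
  have hdeg : (Polynomial.reflect H.natDegree H).natDegree ≤ H.natDegree :=
    Polynomial.natDegree_le_iff_coeff_eq_zero.2 fun i hi ↦ by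
      rw [Polynomial.coeff_reflect, Polynomial.revAt_eq_self_of_lt hi]
      exact Polynomial.coeff_eq_zero_of_natDegree_lt hi
  have hev : ∀ q : Polynomial k,
      Polynomial.eval₂ (algebraMap k (Localization.Away (Polynomial.X : Polynomial k))) x q =
        algebraMap (Polynomial k) (Localization.Away (Polynomial.X : Polynomial k)) q := by
    intro q
    have e : Polynomial.eval₂RingHom (algebraMap k (Localization.Away (Polynomial.X : Polynomial k))) x =
        algebraMap (Polynomial k) (Localization.Away (Polynomial.X : Polynomial k)) :=
      Polynomial.ringHom_ext (fun a ↦ by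
          rw [Polynomial.coe_eval₂RingHom, Polynomial.eval₂_C, IsScalarTower.algebraMap_apply k (Polynomial k)
            (Localization.Away (Polynomial.X : Polynomial k)) a, Polynomial.algebraMap_eq])
        (by rw [Polynomial.coe_eval₂RingHom, Polynomial.eval₂_X])
    exact DFunLike.congr_fun e q
  have h1 : Polynomial.eval₂ (algebraMap k _) u H * x ^ H.natDegree =
      algebraMap (Polynomial k) _ (Polynomial.reflect H.natDegree H) := by
    have := Polynomial.eval₂_reflect_mul_pow (algebraMap k (Localization.Away (Polynomial.X : Polynomial k))) x
      H.natDegree (Polynomial.reflect H.natDegree H) hdeg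
    rw [hrr, hux, hev] at this
    exact this
  -- multiply the hypothesis by `x^N`
  have h2 : Polynomial.eval₂ (algebraMap k _) u H =
      x + x ^ 2 * algebraMap (Polynomial k) (Localization.Away (Polynomial.X : Polynomial k)) G := by
    rw [sub_eq_zero] at h
    linear_combination -h
  have h3 : algebraMap (Polynomial k) (Localization.Away (Polynomial.X : Polynomial k))
      ((Polynomial.X + Polynomial.X ^ 2 * G) * Polynomial.X ^ H.natDegree) =
      algebraMap (Polynomial k) _ (Polynomial.reflect H.natDegree H) := by
    rw [← h1, h2]
    simp only [map_mul, map_add, map_pow, hx]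
  have hinj : Function.Injective (algebraMap (Polynomial k) (Localization.Away (Polynomial.X : Polynomial k))) :=
    IsLocalization.injective _ (Submonoid.powers_le.2 (mem_nonZeroDivisors_iff_right.2 fun q hq ↦
      (Polynomial.isRegular_X (R := k)).right (show q * Polynomial.X = 0 * Polynomial.X by rw [hq, zero_mul])))
  have h4 := congrArg (fun q : Polynomial k ↦ q.coeff (1 + H.natDegree)) (hinj h3)
  simp only [Polynomial.coeff_mul_X_pow, Polynomial.coeff_add, Polynomial.coeff_X_one, Polynomial.coeff_X_pow_mul',
    Polynomial.coeff_reflect] at h4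
  rw [if_neg (by omega), add_zero, Polynomial.revAt_eq_self_of_lt (by omega),
    Polynomial.coeff_eq_zero_of_natDegree_lt (by omega)] at h4
  exact one_ne_zero h4

/-- **THE (−2)-CURVE DOES NOT LIFT.**  In the thickened atlas of `𝒪_{ℙ¹}(−2)` with its smoothing deformation
(`q = s²p + εs`), the zero section `Z` (ideal `(p)` resp. `(q)` on the charts, `(p)·L` on the overlap) has NO lift:
the (0,1) coboundary equation of `exists_isAtlasLift_twisted_iff`, evaluated at `s²p` and divided through, says
`s ≡ H(s⁻¹, s²p) − s²G (mod p)`; under `s ↦ x, p ↦ 0` this is `key_contradiction`.  Geometrically: the obstruction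
is the generator `s⁻¹` of `H¹(ℙ¹, 𝒪(−2)) = k`. [cite: Hartshorne2010, §6 Thm. 6.2 (b)] -/
theorem not_exists_isAtlasLift_minusTwo [Nontrivial k] :
    ¬ ∃ K : Fin 2 → Ideal (A k)[ε],
      IsAtlasLift (fun _ : Fin 2 ↦ fstRingHom (A k)) (fun _ ↦ (ε : (A k)[ε])) (fun α _ ↦ mapRingHom (resM2 k α))
        (fun α β ↦ (twist (thetaFamily k α β) : (L k)[ε] →+* (L k)[ε]).comp (mapRingHom (resM2 k β)))
        (idealZ k) K := by
  rintro hK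
  have 𝔄 := thickenedAtlas_twisted (fun α _ ↦ resM2 k α) (fun _ β ↦ resM2 k β) (idealZ k) (idealZ₂ k)
    (thetaFamily k) (preservesLifts_resM2 k) (fun α β ↦ preservesLifts_resM2 k β α)
  have hsec := isLift_map_chartSection 𝔄 (fun _ ↦ algebraMap (A k) (A k)[ε]) fun _ ↦ fstRingHom_algebraMap
  obtain ⟨φ, hφ⟩ := (exists_isAtlasLift_twisted_iff (fun α _ ↦ resM2 k α) (fun _ β ↦ resM2 k β) (idealZ k)
    (idealZ₂ k) (thetaFamily k) (preservesLifts_resM2 k) (fun α β ↦ preservesLifts_resM2 k β α)).1 hK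
  -- the generator `p/1` of `I_L`, its multiple `s²p = resM2 1 p`, representatives of `φ_α(p)`
  have hX1 : (X 1 : A k) ∈ idealZ k 0 := Ideal.subset_span rfl
  have hX1' : (X 1 : A k) ∈ idealZ k 1 := Ideal.subset_span rfl
  have hmem : algebraMap (A k) (L k) (X 1) ∈ idealZ₂ k 0 1 := Ideal.mem_map_of_mem _ (Ideal.subset_span rfl)
  have hmem₁ : resM2 k 1 (X 1) ∈ idealZ₂ k 0 1 := by
    rw [resM2_one_X_one]
    exact Ideal.mul_mem_left _ _ hmem
  obtain ⟨y₀, hy₀⟩ := Ideal.Quotient.mk_surjective (φ 0 ⟨X 1, hX1⟩)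
  obtain ⟨y₁, hy₁⟩ := Ideal.Quotient.mk_surjective (φ 1 ⟨X 1, hX1'⟩)
  have e0 : resL 𝔄 hsec 0 1 (φ 0) ⟨algebraMap (A k) (L k) (X 1), hmem⟩ =
      Ideal.Quotient.mk (idealZ₂ k 0 1) (algebraMap (A k) (L k) y₀) :=
    resNormal_apply (𝔄.homl 0 1) (𝔄.liftsl 0 1) (hsec 0) (φ 0) ⟨X 1, hX1⟩ y₀ hy₀ hmem
  have e1 : resR 𝔄 hsec 0 1 (φ 1) ⟨resM2 k 1 (X 1), hmem₁⟩ =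
      Ideal.Quotient.mk (idealZ₂ k 0 1) (resM2 k 1 y₁) :=
    resNormal_apply (𝔄.homr 0 1) (𝔄.liftsr 0 1) (hsec 1) (φ 1) ⟨X 1, hX1'⟩ y₁ hy₁ hmem₁
  have hx1 : (⟨resM2 k 1 (X 1), hmem₁⟩ : idealZ₂ k 0 1) =
      (algebraMap (A k) (L k) (X 0) ^ 2) • (⟨algebraMap (A k) (L k) (X 1), hmem⟩ : idealZ₂ k 0 1) :=
    Subtype.ext (by
      show resM2 k 1 (X 1) = algebraMap (A k) (L k) (X 0) ^ 2 • algebraMap (A k) (L k) (X 1)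
      rw [resM2_one_X_one, smul_eq_mul])
  have e1' : resR 𝔄 hsec 0 1 (φ 1)
      ((algebraMap (A k) (L k) (X 0) ^ 2) • (⟨algebraMap (A k) (L k) (X 1), hmem⟩ : idealZ₂ k 0 1)) =
        Ideal.Quotient.mk (idealZ₂ k 0 1) (resM2 k 1 y₁) := by
    rw [← hx1]
    exact e1
  -- the (0,1) coboundary equation at `s²·(p/1)`
  have key : algebraMap (A k) (L k) (X 0) ^ 2 •
      Ideal.Quotient.mk (idealZ₂ k 0 1)
        (theta k (IsLocalization.Away.invSelf (X 0 : A k)) (algebraMap (A k) (L k) (X 1))) =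
      Ideal.Quotient.mk (idealZ₂ k 0 1) (resM2 k 1 y₁) -
        algebraMap (A k) (L k) (X 0) ^ 2 • Ideal.Quotient.mk (idealZ₂ k 0 1) (algebraMap (A k) (L k) y₀) := by
    have h01 := LinearMap.congr_fun (hφ 0 1)
      ((algebraMap (A k) (L k) (X 0) ^ 2) • (⟨algebraMap (A k) (L k) (X 1), hmem⟩ : idealZ₂ k 0 1))
    rw [LinearMap.sub_apply, map_smul (derivToNormal (idealZ₂ k 0 1) (thetaFamily k 0 1)),
      map_smul (resL 𝔄 hsec 0 1 (φ 0)), e1', e0, derivToNormal_apply, thetaFamily_zero_one] at h01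
    exact h01
  rw [theta_algebraMap_X_one] at key
  have hsm : ∀ c a : L k, c • Ideal.Quotient.mk (idealZ₂ k 0 1) a = Ideal.Quotient.mk (idealZ₂ k 0 1) (c * a) :=
    fun _ _ ↦ rfl
  rw [hsm, hsm] at key
  have hc : algebraMap (A k) (L k) (X 0) ^ 2 * IsLocalization.Away.invSelf (X 0 : A k) =
      algebraMap (A k) (L k) (X 0) := by
    rw [pow_two, mul_assoc, IsLocalization.Away.mul_invSelf, mul_one]
  rw [hc, ← map_sub, Ideal.Quotient.eq] at key
  -- `s − (psi y₁ − s² y₀) ∈ (p)·L`; map to `k[x]_x`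
  have hev := ev_eq_zero_of_mem k key
  rw [map_sub, map_sub, map_mul, map_pow, ev_algebraMap_X_zero, ev_algebraMap_eq k y₀, resM2_one,
    RingHom.comp_apply] at hev
  change _ - (ev k (psiHom k (algebraMap (A k) (L k) y₁)) - _) = 0 at hev
  rw [psiHom_algebraMap, ← RingHom.comp_apply (ev k) (psi₀ k), ev_comp_psi₀, eval₂Hom_pair_zero] at hev
  -- `ev s⁻¹ · x = 1`
  have hinv : ev k (IsLocalization.Away.invSelf (X 0 : A k)) *
      algebraMap (Polynomial k) (Localization.Away (Polynomial.X : Polynomial k)) Polynomial.X = 1 := by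
    rw [← ev_algebraMap_X_zero, ← map_mul, mul_comm, IsLocalization.Away.mul_invSelf, map_one]
  exact key_contradiction k _ _ hinv hev

/-- **THE ČECH CLASS OF THE (−2)-CURVE IS NON-ZERO**: the cochain of the trivial local lifts is not a coboundary
(`exists_isAtlasLift_iff` contraposed). [cite: Hartshorne2010, §6 Thm. 6.2 (b)] -/
theorem cechCochain_minusTwo_not_coboundary [Nontrivial k] :
    ¬ ∃ φ : ∀ α : Fin 2, idealZ k α →ₗ[A k] A k ⧸ idealZ k α, ∀ α β,
      cechCochain (thickenedAtlas_minusTwo k) (isLift_trivialLift_doubledLine k) α β =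
        resR (thickenedAtlas_minusTwo k) (isLift_trivialLift_doubledLine k) α β (φ β) -
          resL (thickenedAtlas_minusTwo k) (isLift_trivialLift_doubledLine k) α β (φ α) :=
  fun h ↦ not_exists_isAtlasLift_minusTwo k
    ((exists_isAtlasLift_iff (thickenedAtlas_minusTwo k) (isLift_trivialLift_doubledLine k)).2 h)

end DoubledLine

end EmbeddedDeformation

end Summit.Ventures.HSemireg
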